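import Summits.ValiantsHypothesis.ValiantsHypothesis.Theses.DivisionGap
import Summits.ValiantsHypothesis.ValiantsHypothesis.Theorems.PerDivisionHard.Negative.BooleanShadow
import Literature.Computability.AlgebraicComplexity.QuasiPolynomialFormulasProofs
import Literature.Computability.AlgebraicComplexity.PermanentIrreducible
import Literature.Computability.AlgebraicComplexity.MonotoneStructure
import Literature.Computability.Complexity.Circuit
import Literature.Barriers.PneNP.MonotoneGap

/-!
# Line `kw-depth-shadow` — crux `DivisionGap.PerMultiplesHard` (stmt-ValiantsHypothesis-5068)
# VERDICT OF THE CRUX-PLAN SEAT: **RUNG, NOT A LINE (no-skeleton)** — this file is the CHECKED RUNG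

Crux (route `DivisionGap`, h UNCHARGED): `∀ c, ∃ n₀, ∀ n ≥ n₀, ∀ h ≠ 0, 2^{(log₂ n + c)^c} < L⁺(per_n · h)`
over `ℝ≥0` (`Summit.ValiantsHypothesis.ValiantsHypothesis.Theses.DivisionGap.PerMultiplesHard`).

## The idea (card `Ideas/kw-depth-shadow.md`, triage r1: pass ×3 with a mandatory sharpening)
A monotone arithmetic circuit of size `s` for `g = per_n · h` is balanced (Hyafil / VSBR / BCS (21.36),
IN THE TREE for every commutative semiring: `formulaComplexity_le_two_pow`, hence monotone over `ℝ≥0`)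
into a monotone arithmetic FORMULA of size `2^{18 E²}` (`2^E ≥ s, deg g, n²`); gate by gate
(`+ ↦ ∨`, `× ↦ ∧`, constants `≠ 0 ↦ ⊤`, zero weights `↦ ⊥`, simplified) that formula is a monotone
Boolean formula of no larger size computing the BOOLEAN SHADOW `x ↦ [∃ m ∈ supp g, supp m ⊆ x]`
(`stub_formulaShadow`); when `h` is SUPPORT-COMPLETE (`IsSupportComplete`: for every permutation `ρ`
some monomial of `h` lives inside the pattern of `ρ`) the shadow of `per_n · h` is EXACTLY the bipartite
perfect-matching function (`shadowFn_perPoly_mul`, PROVED below); Raz–Wigderson (STOC 1990, Thm 4.2,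
held `paper:doi-10-1145-100216-100253` p. 13: `d_m(BPM) = Ω(n)`) with monotone formula balancing (Jukna
2012, Lemma 6.1, PDF p. 176–177: depth `≤ 1.82 log₂` leafsize, proof monotone) gives monotone formula size
`2^{Ω(n)}` for `BPM_n` (named fact `RazWigderson1990_formulaSize`, to be vendored).  Net (PROVED here
modulo the fact and `stub_formulaShadow`): `n / K ≤ 18 E²` for every `E ≥ 1` with
`2^E > deg(per·h)`, `2^E ≥ n²`, `2^E ≥ L⁺(per·h)` (`depthShadowBound_of`), and in crux currency
(`depthShadowRung_of`, PROVED): for every `c`, all large `n`, every support-complete `h` in the DEGREE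
WINDOW `(log₂ deg(per·h) + 1)² (log₂ n + 1) ≤ n` has `2^{(log₂ n + c)^c} < L⁺(per_n · h)`.
This is an unconditional, junk-robust rung: it covers `h = 1 + J`, `per^{N-1} + J`, Hadamard-power
mixtures `+ J` for ANY nonnegative `J` (shadow(per·J) ⊆ BPM always) up to degree `2^{√(n / log n)}`,
strictly above the in-tree low-degree rung `PerLowDegreeRung.two_pow_le_complexity_perPoly_mul`
(`deg h ≤ n - 6`) and the recorded Boolean SIZE transfer (Razborov `n^{Ω(log n)}`, Disproof item 3).

## Why it is NOT a line to the crux (the why of `no-skeleton`)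
1. The lever sees only `supp h`.  Off the support-complete class it is VOID or weak: for
   `h = x^{P_id}` the shadow of `per·h` is "`x ⊇` diagonal" (Disproof (d) `shadow_perPoly_mul_diagonal_iff`),
   for `h = x^{P_id} + x^{P_σ}` it is an OR of two ANDs (≤ 2n leaves), and in general
   `shadow(per·h) = BPM ∧ shadow(h)` (shadow is multiplicative over `ℝ≥0`), whose restriction by a
   minterm of `shadow(h)` touching `r` rows is only `BPM_{n-r}` — nothing when every monomial of `h`
   meets `n - polylog` rows.  So no Boolean-depth statement reaches the impure core.
2. After the FREE multihomogeneous reduction (Disproof (h) `perMultiplesHard_iff_multihomogeneous`,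
   sorry-free: WLOG every monomial of `h` has the same row margins and the same column margins),
   support-complete ⟺ PURE-complete of one level `N` (`N·P_π ∈ supp h` for every `π`; proof: the
   monomial inside the pattern of `π` has row margins `a` and column margins `a ∘ π⁻¹`, for all `π`,
   forcing `a = b = N·𝟙`), and that whole class — at ALL degrees, no window — is settled by the TYPED
   PURE-VERTEX COUNT `L⁺(g) ≥ C(n, ⌈n/3⌉)` for every multihomogeneous `g` containing all `(N+1)·P_π`
   (TRIAGE-r1-2 §Typed, TRIAGE-r1-3 F3, re-derived by this seat; registered as stubs 2–3 of the sibling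
   line `Cruxes/PerDivisionHard/Lines/typed-vertex-rectangles.lean`, whose `choose_le_complexity_perPoly_pow`
   certifies `C(n,⌈n/3⌉) ≤ L⁺(per_n^M)` modulo them; = `TypedVertexBoundUnit` / `ThinPatternBound` of the
   5068 cards twin-closure-pincer / uncharged-face-walk).  Stated below as `TypedPureCount` (def only).
3. Hence in ANY proof of the crux the shadow stubs are dead weight: every instance reduces for free to a
   multihomogeneous one, which is either pure-complete (item 2, better bound, all degrees) or of degree
   `≤ n - 3 polylog - 3` (in-tree `PerLowDegreeRung`) or lies in the OPEN CORE
   `ImpureHighDegreeCore` below — where item 1 shows the lever is blind.  A skeleton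
   `stubs → PerMultiplesHard` containing the lever must therefore carry a stub equal to the crux on a
   class CONTAINING that core (costume), and would be strictly dominated by the registered
   typed-vertex line (its residual "pure-poor torus-homogeneous" is smaller).  The lever's only exclusive
   content is unconditional knowledge about INHOMOGENEOUS instances whose pure part is buried under junk
   of more extreme margins (vertex reduction sends those into the open core, so today nothing else proves
   them) — a rung theorem, recorded here for the standing disprover (`-- Rungs`) and for round 2.

## Contents
* defs: `shadowFn`, `IsSupportComplete`, `RazWigderson1990_formulaSize` (named fact, hypothesis),
  `InShadowWindow`, `DepthShadowRung`, `TypedPureCount`, `ImpureHighDegreeCore` (documentation of the core).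
* `stub_formulaShadow` (sorry; provable now, size L: arithmetic formula ↦ Boolean formula for the shadow).
* PROVED: `shadowFn_mul` (shadow is multiplicative over `ℝ≥0`), `isSupportComplete_of_coeff_zero_ne_zero`,
  `IsSupportComplete.add` (junk-robustness), `isSupportComplete_perPoly_pow`,
  `shadowFn_perPoly_mul` (support-complete ⇒ shadow = `perfectMatchingFn`),
  `isSupportComplete_of_shadowFn_eq` (converse), `pureComplete_of_isSupportComplete` (item 2 of the
  verdict: multihomogeneous ∧ support-complete ⇒ pure-complete of one level), `formula_bound_of`,
  `depthShadowBound_of`, `growth`, `depthShadowRung_of` (the crux-currency rung from the fact + the stub),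
  `rung_polynomialDegree`, `rung_perPoly_pow_add_junk` (`h = per^N + J`, any `J ≥ 0`, polynomial degree).
`sorry` occurs only in `stub_formulaShadow`.  There is deliberately NO `PerMultiplesHard_of`.

Disproof used (`Cruxes/PerMultiplesHard/Disproof.lean`, cdisprove cycle 1, read 2026-08-16): (a)
`perMultiplesHard_false_without_nonzero` — support-completeness forces `h ≠ 0`; `_false_without_threshold`,
`_false_uniform` — the rung is `∀ c ∃ n₀(c)`; `not_perMultiplesHardOver_of_charTwo` — the shadow transfer
is exact only without cancellation (`add_mem_support_mul` over `ℝ≥0`); (b) tightness respected (bounds are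
`2^{O(√n)}`-type statements about `log L`, far below `(n+1)·n!`); (d) `shadow_is_perfectMatching` is the
constant-term case of `shadowFn_perPoly_mul`, `shadow_void_at_prod_X` / `shadow_perPoly_mul_monomial_iff`
are exactly item 1 above; (h) `perMultiplesHard_iff_multihomogeneous` is the reduction in item 2; (e) the
exclusion bridge explains why only rungs, never kills, are at stake.  `ledger negatives` (4 determinantal
items): untouched.
-/

noncomputable section

namespace Summit.ValiantsHypothesis.ValiantsHypothesis.Cruxes.PerMultiplesHard.KwDepthShadow

open MvPolynomial
open Literature.Computability.AlgebraicComplexity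
open Literature.Computability.Complexity (formulaSizeOver monotoneBasis)
open Literature.Barriers.PneNP (perfectMatchingFn)
open Summit.ValiantsHypothesis.ValiantsHypothesis.Theses.DivisionGap (PerMultiplesHard)
open Summit.ValiantsHypothesis.Theorems.PerDivisionHardNegative (mem_support_permMonomial
  support_subset_support_add)
open scoped NNReal

set_option linter.unusedVariables false
set_option linter.dupNamespace false

/-! ## Definitions -/

/-- The BOOLEAN SHADOW of a polynomial `g` over `ℝ≥0`: the monotone Boolean function accepting an
input `x` (read as the set of variables set to `true`) iff some monomial of `g` has all its variables
in `x` (Hrubeš–Yehudayoff 2021 §5.1; Disproof (d); `BooleanShadow.lean`). -/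
def shadowFn {ι : Type} (g : MvPolynomial ι ℝ≥0) (x : ι → Bool) : Bool :=
  decide (∃ m ∈ g.support, ∀ v ∈ m.support, x v = true)

/-- `h` is SUPPORT-COMPLETE: for every permutation `ρ` some monomial of `h` lives inside the pattern
`{(ρ j, j)}` of `ρ` (the `perPoly` convention `X (ρ j, j)`).  Examples: any `h` with a constant term,
`per^N + J`, `Σ_j x_{1j}^5 + J`; for MULTIHOMOGENEOUS `h` it is equivalent to pure-completeness of one
level (`N·P_π ∈ supp h` for all `π`).  Exactly the class on which the shadow of `per·h` is `BPM_n`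
(`shadowFn_perPoly_mul`, `isSupportComplete_of_shadowFn_eq`). -/
def IsSupportComplete {n : ℕ} (h : MvPolynomial (Fin n × Fin n) ℝ≥0) : Prop :=
  ∀ ρ : Equiv.Perm (Fin n), ∃ m ∈ h.support, ∀ v ∈ m.support, ρ v.2 = v.1

/-- **Named fact (to be vendored; used as a hypothesis): Raz–Wigderson, monotone formula size of
bipartite perfect matching is `2^{Ω(m)}`.**  Raz–Wigderson, *Monotone circuits for matching require
linear depth*, STOC 1990 (J. ACM 39 (1992) 736–744), Thm 4.2 (held text p. 13): `d_m(BPM) = Ω(n)`;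
with the monotone Formula Balancing Lemma (Jukna 2012, Lemma 6.1, PDF pp. 176–177: a monotone formula
with `ℓ` leaves has an equivalent monotone formula of depth `≤ 1.82 log₂ ℓ`) every monotone formula for
`BPM_m` has `≥ 2^{c m}` leaves, stated here in `ℕ`-form `2^{m / K} ≤` gates (gates = leaves − 1; the
tree's `formulaSizeOver monotoneBasis` counts gates of `{∧₂, ∨₂}`-formulas and `perfectMatchingFn m`
is the bipartite function on `Fin m × Fin m`).  Cf. Jukna 2012 Thm 7.26 / Cor 7.27 (PDF p. 238–241)
for the non-bipartite `MATCH_n`.  Not in `references.bib` yet (RazWigderson1990 to add). -/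
def RazWigderson1990_formulaSize : Prop :=
  ∃ K : ℕ, 0 < K ∧ ∃ m₀ : ℕ, ∀ m ≥ m₀,
    2 ^ (m / K) ≤ formulaSizeOver monotoneBasis (perfectMatchingFn m)

/-- The DEGREE WINDOW of the rung (uniform in the unknown Raz–Wigderson constant):
`(log₂ deg(per_n · h) + 1)² · (log₂ n + 1) ≤ n`, i.e. `deg(per·h) ≤ 2^{√(n/(log₂ n+1)) - 1}`. -/
def InShadowWindow (n : ℕ) (h : MvPolynomial (Fin n × Fin n) ℝ≥0) : Prop :=
  (Nat.log 2 (perPoly (Fin n) ℝ≥0 * h).totalDegree + 1) ^ 2 * (Nat.log 2 n + 1) ≤ n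

/-- **The rung in crux currency.**  `PerMultiplesHard` restricted to support-complete cofactors inside
the degree window — for every `c`, all large `n`, the crux's bound holds for them. -/
def DepthShadowRung : Prop :=
  ∀ c : ℕ, ∃ n₀ : ℕ, ∀ n ≥ n₀, ∀ h : MvPolynomial (Fin n × Fin n) ℝ≥0,
    IsSupportComplete h → InShadowWindow n h →
      2 ^ ((Nat.log 2 n + c) ^ c) < complexity (perPoly (Fin n) ℝ≥0 * h)

/-- (Documentation of item 2 of the header — NOT a stub of this file; it is stubs 2–3 of the sibling
line `Cruxes/PerDivisionHard/Lines/typed-vertex-rectangles.lean` and `TypedVertexBoundUnit` /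
`ThinPatternBound` of the 5068 cards.)  THE TYPED PURE-VERTEX COUNT: a multihomogeneous `g` over `ℝ≥0`
of torus type `(N·𝟙, N·𝟙)`, `N ≥ 1`, `n ≥ 3`, containing every pure monomial `N·P_π` needs
`≥ C(n, ⌊n/3⌋)` gates (every gate of a monotone circuit for a multihomogeneous target is single-typed;
descend along a parse tree of `N·P_π` to the first gate of column-support `k ≤ 2n/3`, `k > n/3`; its type
pins `π` on `k` rows up to `k!(n-k)!` choices).  It settles the crux on the whole support-complete class
after the free multihomogeneous reduction, at all degrees. -/
def TypedPureCount : Prop :=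
  ∀ n ≥ 3, ∀ N ≥ 1, ∀ g : MvPolynomial (Fin n × Fin n) ℝ≥0,
    (∀ m ∈ g.support, (∀ i : Fin n, (∑ j : Fin n, m (i, j)) = N) ∧ ∀ j : Fin n, (∑ i : Fin n, m (i, j)) = N) →
    (∀ π : Equiv.Perm (Fin n), N • permMonomial π ∈ g.support) →
      n.choose (n / 3) ≤ complexity g

/-- (Documentation of the OPEN CORE left by all free reductions and in-tree rungs — NOT attacked by this
idea, and provably invisible to its lever.)  The crux for MULTIHOMOGENEOUS cofactors that are NOT
pure-complete and have degree `> n - 3((log₂ n + c)^c + 1) - 3` (below that the in-tree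
`PerLowDegreeRung.two_pow_le_complexity_perPoly_mul` applies).  With `TypedPureCount` and
`Disproof.TopForm.perMultiplesHard_iff_multihomogeneous` this statement is EQUIVALENT to the crux; it is
the arena of the other three passing cards (unit margins: twin-closure-pincer; sparse: uncharged-face-walk;
LP certificates: typed-parse-tree-weights). -/
def ImpureHighDegreeCore : Prop :=
  ∀ c : ℕ, ∃ n₀ : ℕ, ∀ n ≥ n₀, ∀ h : MvPolynomial (Fin n × Fin n) ℝ≥0, h ≠ 0 →
    (∃ a b : Fin n → ℕ, ∀ m ∈ h.support,
      (∀ i : Fin n, (∑ j : Fin n, m (i, j)) = a i) ∧ ∀ j : Fin n, (∑ i : Fin n, m (i, j)) = b j) →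
    (¬ ∀ π : Equiv.Perm (Fin n), ∃ N : ℕ, N • permMonomial π ∈ h.support) →
    n - 3 * ((Nat.log 2 n + c) ^ c + 1) - 3 < h.totalDegree →
      2 ^ ((Nat.log 2 n + c) ^ c) < complexity (perPoly (Fin n) ℝ≥0 * h)

/-! ## The one stub -/

/-- **Stub — the formula-level shadow transfer** (provable now, size L).  For every polynomial `g`
over `ℝ≥0`, the monotone Boolean formula complexity (basis `{∧₂, ∨₂}`, gate count) of its shadow is at
most its arithmetic formula complexity (fan-in-two weighted formulas, gate count): replace `+`-gates
with positive weights by `∨`, `×`-gates by `∧`, constants `c ≠ 0` by `⊤`, zero weights / zero constants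
by `⊥`, inputs by inputs, and simplify `⊤`/`⊥` away (each gate of the simplified formula comes from a
distinct arithmetic gate; reference counts do not increase, so `IsFormula` is preserved); correctness is
`supp(αu + βv) = supp u ∪ supp v` (`α, β > 0`) and `supp(uv) = supp u + supp v` over `ℝ≥0`
(`add_mem_support_mul`, no zero divisors, no cancellation — false in characteristic two, cf.
`not_perMultiplesHardOver_of_charTwo`).  Degenerate cases hold by the junk convention: if the shadow is
constant (e.g. `g` has a constant term, or `g = 0`) no `{∧₂,∨₂}`-formula computes it and the left side
is `sInf ∅ = 0`; if it is a single variable the gate-free `Circuit.input` computes it with size `0`.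
[HrubesYehudayoff2021 §5.1; Jukna2012 §1.2, §9.?; folklore] -/
theorem stub_formulaShadow {ι : Type} (g : MvPolynomial ι ℝ≥0) :
    formulaSizeOver monotoneBasis (shadowFn g) ≤ formulaComplexity g := by
  sorry

/-! ## Proved: the shadow of `per_n · h` is bipartite perfect matching iff `h` is support-complete -/

/-- **Support-complete cofactors give the perfect-matching shadow** (both inclusions: `⊆` because
every monomial of `per·h` dominates a permutation pattern — `support_mul`,
`exists_permMonomial_eq_of_coeff_perPoly_ne_zero`; `⊇` from the monomial `P_ρ + m_ρ` with
`supp m_ρ ⊆` pattern of `ρ` — `add_mem_support_mul`, `coeff_permMonomial_perPoly`). [folklore] -/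
theorem shadowFn_perPoly_mul {n : ℕ} {h : MvPolynomial (Fin n × Fin n) ℝ≥0}
    (hh : IsSupportComplete h) :
    shadowFn (perPoly (Fin n) ℝ≥0 * h) = perfectMatchingFn n := by
  classical
  funext x
  unfold shadowFn perfectMatchingFn
  rw [Bool.eq_iff_iff]
  simp only [decide_eq_true_iff]
  constructor
  · rintro ⟨m, hm, hmx⟩
    obtain ⟨m₁, hm₁, m₂, -, rfl⟩ := Finset.mem_add.1 (support_mul _ _ hm)
    obtain ⟨ρ, rfl⟩ := exists_permMonomial_eq_of_coeff_perPoly_ne_zero ℝ≥0 (mem_support_iff.1 hm₁)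
    refine ⟨ρ.symm, fun i => hmx _ ?_⟩
    have hi : (i, ρ.symm i) ∈ (permMonomial ρ).support :=
      (mem_support_permMonomial ρ (i, ρ.symm i)).2 (by simp)
    exact support_subset_support_add _ _ hi
  · rintro ⟨σ, hσ⟩
    obtain ⟨m₂, hm₂, hρ⟩ := hh σ.symm
    refine ⟨permMonomial σ.symm + m₂, add_mem_support_mul ?_ hm₂, fun v hv => ?_⟩
    · rw [mem_support_iff, coeff_permMonomial_perPoly]; exact one_ne_zero
    · have hv' : σ.symm v.2 = v.1 := by
        rcases Finset.mem_union.1 (Finsupp.support_add hv) with h1 | h2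
        · exact (mem_support_permMonomial _ _).1 h1
        · exact hρ v h2
      have hv2 : σ v.1 = v.2 := by rw [← hv']; simp
      have := hσ v.1
      rwa [hv2, Prod.mk.eta] at this

/-- **Converse: if the shadow of `per_n · h` is perfect matching then `h` is support-complete** (test
the shadow on the pattern of `ρ` itself: the accepting monomial is `P_τ + m` with pattern of `τ` inside
the pattern of `ρ`, so `τ = ρ` … in fact only `supp m ⊆` pattern of `ρ` is needed). [folklore] -/
theorem isSupportComplete_of_shadowFn_eq {n : ℕ} {h : MvPolynomial (Fin n × Fin n) ℝ≥0}
    (hs : shadowFn (perPoly (Fin n) ℝ≥0 * h) = perfectMatchingFn n) : IsSupportComplete h := by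
  classical
  intro ρ
  -- the input "pattern of ρ"
  set x : Fin n × Fin n → Bool := fun v => decide (ρ v.2 = v.1) with hxdef
  have hpm : perfectMatchingFn n x = true := by
    unfold perfectMatchingFn
    simp only [decide_eq_true_iff]
    exact ⟨ρ.symm, fun i => by simp [hxdef]⟩
  rw [← hs] at hpm
  unfold shadowFn at hpm
  simp only [decide_eq_true_iff] at hpm
  obtain ⟨m, hm, hmx⟩ := hpm
  obtain ⟨m₁, -, m₂, hm₂, rfl⟩ := Finset.mem_add.1 (support_mul _ _ hm)
  refine ⟨m₂, hm₂, fun v hv => ?_⟩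
  have := hmx v (by rw [add_comm]; exact support_subset_support_add _ _ hv)
  simpa [hxdef] using this

/-! ## Proved: the shadow is multiplicative; the support-complete class is closed under junk -/

/-- **Over `ℝ≥0` the shadow is multiplicative:** `shadow(f·g) = shadow(f) ∧ shadow(g)` (item 1 of the
verdict: `shadow(per·h) = BPM ∧ shadow(h)`, so the lever can never see more than `supp h`). [folklore] -/
theorem shadowFn_mul {ι κ : Type} (f g : MvPolynomial (ι × κ) ℝ≥0) (x : ι × κ → Bool) :
    shadowFn (f * g) x = (shadowFn f x && shadowFn g x) := by
  classical
  unfold shadowFn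
  rw [Bool.eq_iff_iff]
  simp only [Bool.and_eq_true, decide_eq_true_iff]
  constructor
  · rintro ⟨m, hm, hmx⟩
    obtain ⟨m₁, hm₁, m₂, hm₂, rfl⟩ := Finset.mem_add.1 (support_mul _ _ hm)
    refine ⟨⟨m₁, hm₁, fun v hv => hmx v (support_subset_support_add _ _ hv)⟩,
      ⟨m₂, hm₂, fun v hv => hmx v ?_⟩⟩
    rw [add_comm]
    exact support_subset_support_add _ _ hv
  · rintro ⟨⟨m₁, hm₁, h₁⟩, ⟨m₂, hm₂, h₂⟩⟩
    refine ⟨m₁ + m₂, add_mem_support_mul hm₁ hm₂, fun v hv => ?_⟩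
    rcases Finset.mem_union.1 (Finsupp.support_add hv) with hv | hv
    · exact h₁ v hv
    · exact h₂ v hv

/-- A constant term makes `h` support-complete (the empty monomial lives inside every pattern). -/
theorem isSupportComplete_of_coeff_zero_ne_zero {n : ℕ} {h : MvPolynomial (Fin n × Fin n) ℝ≥0}
    (h0 : coeff 0 h ≠ 0) : IsSupportComplete h :=
  fun _ => ⟨0, mem_support_iff.2 h0, fun v hv => absurd hv (by simp)⟩

/-- **Junk-robustness:** adding ANY nonnegative `J` keeps `h` support-complete (no cancellation). -/
theorem IsSupportComplete.add {n : ℕ} {h : MvPolynomial (Fin n × Fin n) ℝ≥0}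
    (hh : IsSupportComplete h) (J : MvPolynomial (Fin n × Fin n) ℝ≥0) : IsSupportComplete (h + J) := by
  intro ρ
  obtain ⟨m, hm, hpat⟩ := hh ρ
  refine ⟨m, ?_, hpat⟩
  rw [mem_support_iff] at hm ⊢
  rw [coeff_add]
  exact ne_of_gt (lt_of_lt_of_le (pos_iff_ne_zero.2 hm) le_self_add)

/-- Powers of the permanent are support-complete (`N·P_ρ ∈ supp per^N`; `N = 0`: the constant `1`). -/
theorem isSupportComplete_perPoly_pow {n : ℕ} (N : ℕ) :
    IsSupportComplete (perPoly (Fin n) ℝ≥0 ^ N) := by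
  classical
  have key : ∀ N : ℕ, ∀ ρ : Equiv.Perm (Fin n), N • permMonomial ρ ∈ (perPoly (Fin n) ℝ≥0 ^ N).support := by
    intro N ρ
    induction N with
    | zero =>
      rw [zero_smul, pow_zero, mem_support_iff, coeff_one, if_pos rfl]
      exact one_ne_zero
    | succ N ih =>
      rw [pow_succ, succ_nsmul]
      refine add_mem_support_mul ih ?_
      rw [mem_support_iff, coeff_permMonomial_perPoly]
      exact one_ne_zero
  intro ρ
  refine ⟨N • permMonomial ρ, key N ρ, fun v hv => ?_⟩
  have hv' : v ∈ (permMonomial ρ).support := by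
    rw [Finsupp.mem_support_iff] at hv ⊢
    rw [Finsupp.smul_apply, smul_eq_mul] at hv
    exact fun h0 => hv (by rw [h0, mul_zero])
  exact (mem_support_permMonomial ρ v).1 hv'

/-! ## Proved: for MULTIHOMOGENEOUS cofactors, support-complete = pure-complete of one level

(Item 2 of the verdict.)  If every monomial of `h` has row margins `a` and column margins `b`, and `h`
is support-complete, then `a = b = N·𝟙` and `N·P_π ∈ supp h` for every permutation `π` — i.e. `h` is
in the domain of the typed pure-vertex count `TypedPureCount` (applied to `per_n · h`, level `N+1`). -/

/-- **Support-complete multihomogeneous cofactors are pure-complete of a single level.** [folklore] -/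
theorem pureComplete_of_isSupportComplete {n : ℕ} (hn : 0 < n)
    {h : MvPolynomial (Fin n × Fin n) ℝ≥0} {a b : Fin n → ℕ}
    (hmh : ∀ m ∈ h.support, (∀ i : Fin n, (∑ j : Fin n, m (i, j)) = a i) ∧
      ∀ j : Fin n, (∑ i : Fin n, m (i, j)) = b j)
    (hs : IsSupportComplete h) :
    ∃ N : ℕ, (∀ j, b j = N) ∧ (∀ i, a i = N) ∧
      ∀ π : Equiv.Perm (Fin n), N • permMonomial π ∈ h.support := by
  classical
  -- for each `π` pick the monomial of `h` inside its pattern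
  choose m hm hpat using hs
  -- its entries are the column margins …
  have hcol : ∀ (π : Equiv.Perm (Fin n)) (j : Fin n), m π (π j, j) = b j := by
    intro π j
    have h1 := (hmh _ (hm π)).2 j
    rw [Finset.sum_eq_single (π j)] at h1
    · exact h1
    · intro i _ hi
      by_contra hne
      exact hi (hpat π (i, j) (Finsupp.mem_support_iff.2 hne)).symm
    · intro hh
      exact absurd (Finset.mem_univ _) hh
  -- … and the row margins along `π`
  have hrow : ∀ (π : Equiv.Perm (Fin n)) (j : Fin n), a (π j) = b j := by
    intro π j
    have h1 := (hmh _ (hm π)).1 (π j)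
    rw [Finset.sum_eq_single j] at h1
    · rw [← h1, hcol]
    · intro j' _ hj'
      by_contra hne
      have hπ : π j' = π j := hpat π (π j, j') (Finsupp.mem_support_iff.2 hne)
      exact hj' (π.injective hπ)
    · intro hh
      exact absurd (Finset.mem_univ _) hh
  set j₀ : Fin n := ⟨0, hn⟩ with hj₀
  have hb : ∀ j, b j = b j₀ := by
    intro j
    have h1 := hrow (Equiv.swap j j₀) j
    have h2 := hrow (Equiv.refl _) j₀
    rw [Equiv.swap_apply_left] at h1
    rw [Equiv.refl_apply] at h2
    rw [← h1, h2]
  have ha : ∀ i, a i = b j₀ := by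
    intro i
    have h2 := hrow (Equiv.refl _) i
    rw [Equiv.refl_apply] at h2
    rw [h2, hb]
  refine ⟨b j₀, hb, ha, fun π => ?_⟩
  have heq : b j₀ • permMonomial π = m π := by
    ext ⟨r, c'⟩
    rw [Finsupp.smul_apply, permMonomial_apply, smul_eq_mul]
    split_ifs with hrc
    · subst hrc
      rw [mul_one, hcol π c', hb c']
    · rw [mul_zero]
      symm
      by_contra hne
      exact hrc (hpat π (r, c') (Finsupp.mem_support_iff.2 hne))
  rw [heq]
  exact hm π

/-! ## Proved: the composition (natural form, then crux currency) -/

/-- Raz–Wigderson + the shadow transfer + `shadowFn_perPoly_mul`: **arithmetic FORMULAS over `ℝ≥0`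
for `per_n · h`, `h` support-complete, have size `≥ 2^{n/K}`** (junk-robust, degree-free). -/
theorem formula_bound_of (rw : RazWigderson1990_formulaSize) :
    ∃ K : ℕ, 0 < K ∧ ∃ m₀ : ℕ, ∀ n ≥ m₀, ∀ h : MvPolynomial (Fin n × Fin n) ℝ≥0,
      IsSupportComplete h → 2 ^ (n / K) ≤ formulaComplexity (perPoly (Fin n) ℝ≥0 * h) := by
  obtain ⟨K, hK, m₀, hm₀⟩ := rw
  refine ⟨K, hK, m₀, fun n hn h hh => ?_⟩
  calc 2 ^ (n / K) ≤ formulaSizeOver monotoneBasis (perfectMatchingFn n) := hm₀ n hn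
    _ = formulaSizeOver monotoneBasis (shadowFn (perPoly (Fin n) ℝ≥0 * h)) := by
        rw [shadowFn_perPoly_mul hh]
    _ ≤ formulaComplexity (perPoly (Fin n) ℝ≥0 * h) := stub_formulaShadow _

/-- **The depth–shadow bound (natural form):** with BCS (21.36) in the tree
(`formulaComplexity_le_two_pow`: `E(g) ≤ 2^{18E²}` once `2^E > deg g`, `2^E ≥ #vars, L(g)`), every
exponent `E` dominating `log₂ L⁺(per_n·h)`, `log₂ deg(per_n·h)` and `2 log₂ n` satisfies
`n / K ≤ 18 E²` — i.e. `log₂ L⁺(per_n · h) ≥ √(n/18K)` unless the degree or `n²` is the bigger term. -/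
theorem depthShadowBound_of (rw : RazWigderson1990_formulaSize) :
    ∃ K : ℕ, 0 < K ∧ ∃ m₀ : ℕ, ∀ n ≥ m₀, ∀ h : MvPolynomial (Fin n × Fin n) ℝ≥0,
      IsSupportComplete h → ∀ E : ℕ, 1 ≤ E →
        (perPoly (Fin n) ℝ≥0 * h).totalDegree < 2 ^ E → n * n ≤ 2 ^ E →
        complexity (perPoly (Fin n) ℝ≥0 * h) ≤ 2 ^ E → n / K ≤ 18 * E ^ 2 := by
  obtain ⟨K, hK, m₀, hm₀⟩ := formula_bound_of rw
  refine ⟨K, hK, m₀, fun n hn h hh E hE hD hcard hL => ?_⟩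
  have hn2 : Fintype.card (Fin n × Fin n) ≤ 2 ^ E := by
    simpa [Fintype.card_prod, Fintype.card_fin] using hcard
  have hF := formulaComplexity_le_two_pow (g := perPoly (Fin n) ℝ≥0 * h) le_rfl hD hn2 hL hE
  exact (Nat.pow_le_pow_iff_right (by norm_num)).1 ((hm₀ n hn h hh).trans hF)

/-- Polylog versus exponential: `A (L + k)^k < 2^L` for all large `L`. [folklore] -/
theorem growth (A k : ℕ) : ∃ L₀ : ℕ, ∀ L ≥ L₀, A * (L + k) ^ k < 2 ^ L := by
  have ht := tendsto_pow_const_div_const_pow_of_one_lt k (one_lt_two : (1 : ℝ) < 2)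
  have hε : (0 : ℝ) < 1 / ((A + 1) * 2 ^ k) := by positivity
  obtain ⟨N, hN⟩ := Filter.eventually_atTop.1 (ht.eventually (Iio_mem_nhds hε))
  refine ⟨N, fun L hL => ?_⟩
  have hM := hN (L + k) (by omega)
  rw [div_lt_iff₀ (by positivity)] at hM
  have key : (1 / ((A + 1) * 2 ^ k) * 2 ^ (L + k) : ℝ) = 2 ^ L / (A + 1) := by
    rw [pow_add]; field_simp
  rw [key, lt_div_iff₀ (by positivity)] at hM
  -- hM : (L + k)^k * (A + 1) < 2^L  (as reals, with casts)
  have h8 : ((A * (L + k) ^ k : ℕ) : ℝ) < ((2 ^ L : ℕ) : ℝ) := by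
    push_cast at hM ⊢
    have hX : (0 : ℝ) ≤ ((L : ℝ) + k) ^ k := by positivity
    have hre : ((L : ℝ) + k) ^ k * ((A : ℝ) + 1) = (A : ℝ) * ((L : ℝ) + k) ^ k + ((L : ℝ) + k) ^ k := by
      ring
    rw [hre] at hM
    linarith
  exact_mod_cast h8

/-- **The rung in crux currency, from the named fact and the one stub** (the composition the card and
the triage asked for, with the PRINTED / in-tree balancing exponent `18 E²`, hence the window
`log₂² deg · log₂ n ≤ n`, not the card's over-strong `n / polylog`): for every `c`, all `n ≥ n₀(c)`,
every support-complete `h` in the window has `2^{(log₂ n + c)^c} < L⁺(per_n · h)`.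
Bookkeeping: if `L⁺ ≤ 2^P`, `P = (log₂ n + c)^c`, take `E = P + W + 2 log₂ n + 2`, `W = log₂ deg + 1`;
then `n/K ≤ 18E² ≤ 36(P + 2log₂ n + 2)² + 36 W²`, and `36K·W² ≤ 36K·n/(log₂ n + 1) ≤ n/4`,
`36K(P + 2 log₂ n + 2)² ≤ 324K(log₂ n + 2c + 2)^{2c+2} ≤ n/4` (`growth`), `K ≤ n/4` — contradiction. -/
theorem depthShadowRung_of (rw : RazWigderson1990_formulaSize) : DepthShadowRung := by
  obtain ⟨K, hK, m₀, hm₀⟩ := depthShadowBound_of rw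
  intro c
  obtain ⟨L₀, hL₀⟩ := growth (1296 * K) (2 * c + 2)
  -- opaque names for the two powers in the threshold (keeps `omega` linear)
  obtain ⟨T₁, hT₁⟩ : ∃ T₁, T₁ = 2 ^ L₀ := ⟨_, rfl⟩
  obtain ⟨T₂, hT₂⟩ : ∃ T₂, T₂ = 2 ^ (144 * K) := ⟨_, rfl⟩
  refine ⟨m₀ + T₁ + T₂ + 4 * K + 1, fun n hn h hh hW => ?_⟩
  by_contra hlt
  rw [not_lt] at hlt
  -- abbreviations
  set L := Nat.log 2 n with hLdef
  set P := (L + c) ^ c with hPdef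
  set D := (perPoly (Fin n) ℝ≥0 * h).totalDegree with hDdef
  set W := Nat.log 2 D + 1 with hWdef
  have hnm₀ : m₀ ≤ n := by omega
  have hn0 : n ≠ 0 := by omega
  have h2L : 2 ^ L ≤ n := Nat.pow_log_le_self 2 hn0
  have hnlt : n < 2 ^ (L + 1) := Nat.lt_pow_succ_log_self (by norm_num) n
  have hT₁n : 2 ^ L₀ ≤ n := by rw [← hT₁]; omega
  have hT₂n : 2 ^ (144 * K) ≤ n := by rw [← hT₂]; omega
  have hLL₀ : L₀ ≤ L := Nat.le_log_of_pow_le (by norm_num) hT₁n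
  have hLK : 144 * K ≤ L := Nat.le_log_of_pow_le (by norm_num) hT₂n
  have hDW : D < 2 ^ W := Nat.lt_pow_succ_log_self (by norm_num) D
  -- the exponent `E`
  set a := P + 2 * L + 2 with hadef
  set E := a + W with hEdef
  have hE1 : 1 ≤ E := by omega
  have hDE : D < 2 ^ E := hDW.trans_le (Nat.pow_le_pow_right (by norm_num) (by omega))
  have hcard : n * n ≤ 2 ^ E := by
    have h1 : n * n < 2 ^ (L + 1) * 2 ^ (L + 1) := Nat.mul_self_lt_mul_self hnlt
    rw [← pow_add] at h1
    exact h1.le.trans (Nat.pow_le_pow_right (by norm_num) (by omega))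
  have hLE : complexity (perPoly (Fin n) ℝ≥0 * h) ≤ 2 ^ E :=
    hlt.trans (Nat.pow_le_pow_right (by norm_num) (by omega))
  have key : n / K ≤ 18 * E ^ 2 := hm₀ n hnm₀ h hh E hE1 hDE hcard hLE
  -- the window: `W² (L+1) ≤ n`
  have hW' : W ^ 2 * (L + 1) ≤ n := hW
  have hW2 : W ^ 2 ≤ n / (L + 1) := (Nat.le_div_iff_mul_le (by omega)).2 hW'
  -- (i) `36K · W² ≤ n/4`
  have hi : 36 * K * (n / (L + 1)) ≤ n / 4 := by
    have h1 : n / (L + 1) ≤ n / (144 * K) := Nat.div_le_div_left (by omega) (by omega)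
    calc 36 * K * (n / (L + 1)) ≤ 36 * K * (n / (144 * K)) := Nat.mul_le_mul_left _ h1
      _ ≤ 36 * K * n / (144 * K) := Nat.mul_div_le_mul_div_assoc _ _ _
      _ = 36 * K * n / (36 * K * 4) := by rw [show 144 * K = 36 * K * 4 by ring]
      _ = n / 4 := Nat.mul_div_mul_left n 4 (by omega)
  have hW3 : 36 * K * W ^ 2 ≤ n / 4 := (Nat.mul_le_mul_left _ hW2).trans hi
  -- (ii) `36K · a² ≤ n/4`
  set B := (L + (2 * c + 2)) ^ (c + 1) with hBdef
  have hbase : 1 ≤ L + (2 * c + 2) := by omega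
  have hPB : P ≤ B := by
    calc P = (L + c) ^ c := rfl
      _ ≤ (L + (2 * c + 2)) ^ c := Nat.pow_le_pow_left (by omega) c
      _ ≤ (L + (2 * c + 2)) ^ (c + 1) := Nat.pow_le_pow_right hbase (by omega)
  have hLB : 2 * L + 2 ≤ 2 * B := by
    have : L + (2 * c + 2) ≤ B := Nat.le_self_pow (by omega) _
    omega
  have ha3 : a ≤ 3 * B := by omega
  have hB2 : B ^ 2 = (L + (2 * c + 2)) ^ (2 * c + 2) := by
    rw [hBdef, ← pow_mul]; ring_nf
  have hgrowth := hL₀ L hLL₀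
  have hii : 36 * K * a ^ 2 ≤ n / 4 := by
    have h1 : a ^ 2 ≤ (3 * B) ^ 2 := Nat.pow_le_pow_left ha3 2
    have h2 : 4 * (36 * K * a ^ 2) ≤ n := by
      calc 4 * (36 * K * a ^ 2) ≤ 4 * (36 * K * (3 * B) ^ 2) := by gcongr
        _ = 1296 * K * (L + (2 * c + 2)) ^ (2 * c + 2) := by rw [← hB2]; ring
        _ ≤ 2 ^ L := hgrowth.le
        _ ≤ n := h2L
    exact (Nat.le_div_iff_mul_le (by norm_num)).2 (by linarith)
  -- (iii) `K ≤ n/4`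
  have hK4 : K ≤ n / 4 := (Nat.le_div_iff_mul_le (by norm_num)).2 (by omega)
  -- combine: `E² ≤ 2a² + 2W²`
  have hE2 : E ^ 2 ≤ 2 * a ^ 2 + 2 * W ^ 2 := by
    have : ((E : ℤ)) ^ 2 ≤ 2 * (a : ℤ) ^ 2 + 2 * (W : ℤ) ^ 2 := by
      have hE' : (E : ℤ) = a + W := by simp [hEdef]
      rw [hE']
      nlinarith [sq_nonneg ((a : ℤ) - W)]
    exact_mod_cast this
  have hfin : n / K ≤ 18 * (2 * a ^ 2 + 2 * W ^ 2) := key.trans (Nat.mul_le_mul_left _ hE2)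
  have hlt2 : n < (18 * (2 * a ^ 2 + 2 * W ^ 2) + 1) * K :=
    (Nat.div_lt_iff_lt_mul hK).1 (Nat.lt_succ_of_le hfin)
  have hge : (18 * (2 * a ^ 2 + 2 * W ^ 2) + 1) * K ≤ n := by
    have h3 : n / 4 + n / 4 + n / 4 ≤ n := by omega
    calc (18 * (2 * a ^ 2 + 2 * W ^ 2) + 1) * K = 36 * K * a ^ 2 + 36 * K * W ^ 2 + K := by ring
      _ ≤ n / 4 + n / 4 + n / 4 := add_le_add (add_le_add hii hW3) hK4
      _ ≤ n := h3
  exact absurd hge (not_le.2 hlt2)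

/-- The rung implies, a fortiori, the crux's bound on support-complete cofactors of POLYNOMIAL (indeed
quasi-polynomial) degree — e.g. `h = per_n^{N-1} + J` with `deg J ≤ n^k` — recorded as the shape a
`-- Rungs` entry of the Disproof would take. -/
theorem rung_polynomialDegree (rw : RazWigderson1990_formulaSize) (k c : ℕ) :
    ∃ n₀ : ℕ, ∀ n ≥ n₀, ∀ h : MvPolynomial (Fin n × Fin n) ℝ≥0,
      IsSupportComplete h → (perPoly (Fin n) ℝ≥0 * h).totalDegree ≤ n ^ k →
        2 ^ ((Nat.log 2 n + c) ^ c) < complexity (perPoly (Fin n) ℝ≥0 * h) := by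
  obtain ⟨n₁, hn₁⟩ := depthShadowRung_of rw c
  -- window for polynomial degree: `((k+1)(log₂ n + 1))² (log₂ n + 1) ≤ n` eventually
  obtain ⟨L₀, hL₀⟩ := growth ((k + 1) ^ 2) 3
  obtain ⟨T₁, hT₁⟩ : ∃ T₁, T₁ = 2 ^ L₀ := ⟨_, rfl⟩
  refine ⟨n₁ + T₁ + 1, fun n hn h hh hdeg => hn₁ n (by omega) h hh ?_⟩
  have hn0 : n ≠ 0 := by omega
  set L := Nat.log 2 n with hLdef
  set D := (perPoly (Fin n) ℝ≥0 * h).totalDegree with hDdef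
  have h2L : 2 ^ L ≤ n := Nat.pow_log_le_self 2 hn0
  have hnlt : n < 2 ^ (L + 1) := Nat.lt_pow_succ_log_self (by norm_num) n
  have hT₁n : 2 ^ L₀ ≤ n := by rw [← hT₁]; omega
  have hLL₀ : L₀ ≤ L := Nat.le_log_of_pow_le (by norm_num) hT₁n
  -- `log₂ D ≤ log₂ (n^k) ≤ (L+1) k`
  have hlog : Nat.log 2 D ≤ (L + 1) * k := by
    calc Nat.log 2 D ≤ Nat.log 2 (n ^ k) := Nat.log_mono_right hdeg
      _ ≤ Nat.log 2 ((2 ^ (L + 1)) ^ k) := Nat.log_mono_right (Nat.pow_le_pow_left hnlt.le k)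
      _ = (L + 1) * k := by rw [← pow_mul, Nat.log_pow (by norm_num)]
  have hWle : Nat.log 2 D + 1 ≤ (L + 1) * (k + 1) := by
    have : (L + 1) * (k + 1) = (L + 1) * k + (L + 1) := by ring
    omega
  show (Nat.log 2 D + 1) ^ 2 * (L + 1) ≤ n
  calc (Nat.log 2 D + 1) ^ 2 * (L + 1) ≤ ((L + 1) * (k + 1)) ^ 2 * (L + 1) :=
        Nat.mul_le_mul_right _ (Nat.pow_le_pow_left hWle 2)
    _ = (k + 1) ^ 2 * (L + 1) ^ 3 := by ring
    _ ≤ (k + 1) ^ 2 * (L + 3) ^ 3 := by gcongr; omega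
    _ ≤ 2 ^ L := (hL₀ L hLL₀).le
    _ ≤ n := h2L

/-- **Example family settled by the rung (modulo the fact and the stub): `h = per_n^N + J`, ANY
nonnegative junk `J`, polynomial degree** — the power family of HY21 Rem. 45–46 with arbitrary additive
junk, where the typed count needs the pure part to be a free vertex and the Boolean SIZE transfer stops
at `n^{Ω(log n)}`. -/
theorem rung_perPoly_pow_add_junk (rw : RazWigderson1990_formulaSize) (k c : ℕ) :
    ∃ n₀ : ℕ, ∀ n ≥ n₀, ∀ N : ℕ, ∀ J : MvPolynomial (Fin n × Fin n) ℝ≥0,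
      (perPoly (Fin n) ℝ≥0 * (perPoly (Fin n) ℝ≥0 ^ N + J)).totalDegree ≤ n ^ k →
        2 ^ ((Nat.log 2 n + c) ^ c) <
          complexity (perPoly (Fin n) ℝ≥0 * (perPoly (Fin n) ℝ≥0 ^ N + J)) := by
  obtain ⟨n₀, hn₀⟩ := rung_polynomialDegree rw k c
  exact ⟨n₀, fun n hn N J hdeg => hn₀ n hn _ ((isSupportComplete_perPoly_pow N).add J) hdeg⟩

end Summit.ValiantsHypothesis.ValiantsHypothesis.Cruxes.PerMultiplesHard.KwDepthShadow

end
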